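import Literature.AlgebraicGeometry.ComplexMultiplication.IsotypicCMEndAlgebra
import Literature.AlgebraicGeometry.Motives.AbelianVarietyEndAlgebraOrthogonalBiproduct
import Literature.AlgebraicGeometry.Motives.AbelianVarietyIsotypicDecomposition
import HarnessLib

/-!
# `End⁰(⨁ᵢ Bᵢ^{nᵢ+1}) ≅ ∏ᵢ Mat_{nᵢ+1}(End⁰ Bᵢ)` and the structure of `End⁰(X)` for every complex abelian variety
# (Mumford §19); the CM case

Part 1 (`End⁰` of a biproduct of powers of an orthogonal family; `CMProductEndAlgebra`): for pairwise non-isogenous simple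
`Bᵢ`, `End⁰(⨁ᵢ Bᵢ^{nᵢ+1}) ≅ ∏ᵢ Mat_{nᵢ+1}(End⁰ Bᵢ)` — dimension `Σᵢ (nᵢ+1)² dim_ℚ End⁰(Bᵢ)` and commutativity iff all
`nᵢ = 0` and all `End⁰(Bᵢ)` are commutative; the CM case (`End⁰(Bᵢ)` a field of degree `2 dim Bᵢ`).
Part 2 (`EndAlgebraStructure`): CM-type of finite biproducts (`isOfCMType_biproduct_fin_iff`,
`isOfCMType_biproduct_powers_iff`); **every complex `X`** is isogenous to some `⨁ᵢ Bᵢ^{nᵢ+1}` (`Bᵢ` simple,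
positive-dimensional, pairwise non-isogenous) with `dim_ℚ End⁰(X) = Σᵢ (nᵢ+1)² dim_ℚ End⁰(Bᵢ)` and `End⁰(X)` commutative iff
all `nᵢ = 0` and all `End⁰(Bᵢ)` commutative (`exists_endAlgebra_structure`); the CM refinement
(`IsOfCMType.exists_endAlgebra_structure`).

Provenance: Literature home (namespace `Literature.AlgebraicGeometry.ComplexMultiplication.CMProductEnd`) of the Summits-side
`CorCM/CMProductEndAlgebra` and `CorCM/EndAlgebraStructure` (imports `Literature/` and Mathlib only). Lane `lit-hodgefound`
(Layer A3), seat p20.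

## References
* [MumfordAV1970] D. Mumford, *Abelian Varieties* (1970), §19 Thm. 1, Cor. 1–2 and p. 174.
* [Shimura1998] G. Shimura, *Abelian Varieties with Complex Multiplication and Modular Functions* (1998), §5.1 Propositions 1, 3, 4, 6.
* [Milne1999] J. S. Milne, *Lefschetz motives and the Tate conjecture*, Compositio Math. 117 (1999), §2 p. 54.
-/

noncomputable section

namespace Literature.AlgebraicGeometry.ComplexMultiplication.CMProductEnd

/-! ## Part 1: End⁰ of a biproduct of powers of an orthogonal family -/

section Part1

open _root_.CategoryTheory _root_.CategoryTheory.Limits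

open Literature.AlgebraicGeometry.Motives Literature.AlgebraicGeometry.Motives.AbelianVariety
open Literature.AlgebraicGeometry.ComplexMultiplication
open Literature.AlgebraicGeometry.Milne1999 (IsOfCMType IsOfCMTypeSimple)
open Literature.AlgebraicGeometry.ComplexMultiplication.AndreRiemann Literature.AlgebraicGeometry.ComplexMultiplication.EndAlgebraPower
open Literature.AlgebraicGeometry.ComplexMultiplication.IsotypicCM

universe u

/-! ## §1 Any field: `End⁰` of a biproduct of powers of an orthogonal family -/

section AnyField

variable {k : Type u} [Field k] {ι : Type} [Fintype ι] [DecidableEq ι]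
  {B : ι → AbelianVariety k} {n : ι → ℕ}

omit [Fintype ι] [DecidableEq ι] in
/-- The powers `Bⱼ^{nⱼ+1}`, `Bₗ^{nₗ+1}` of orthogonal `Bⱼ`, `Bₗ` are orthogonal.
[cite: MumfordAV1970, §19 (p. 174)] -/
theorem orthogonal_biproduct_powers (horth : ∀ j l, j ≠ l → ∀ f : B j ⟶ B l, f = 0) :
    ∀ j l, j ≠ l →
      ∀ f : (⨁ fun _ : Fin (n j + 1) => B j) ⟶ (⨁ fun _ : Fin (n l + 1) => B l), f = 0 :=
  fun j l hjl f => hom_biproduct_eq_zero (fun _ _ g => horth j l hjl g) f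

/-- **`dim_ℚ End⁰(⨁ᵢ Bᵢ^{nᵢ+1}) = Σᵢ (nᵢ+1)² dim_ℚ End⁰(Bᵢ)`** for an orthogonal family `B` (Mumford:
`End⁰ = ⊕ᵢ M_{nᵢ}(Dᵢ)`). [cite: MumfordAV1970, §19 (p. 174)] [cite: Shimura1998, §5.1 (proof of Proposition 3)] -/
theorem finrank_endAlgebra_biproduct_powers (horth : ∀ j l, j ≠ l → ∀ f : B j ⟶ B l, f = 0) :
    Module.finrank ℚ (⨁ fun i => ⨁ fun _ : Fin (n i + 1) => B i).endAlgebra =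
      ∑ i, (n i + 1) ^ 2 * Module.finrank ℚ (B i).endAlgebra := by
  rw [finrank_endAlgebra_biproduct_eq_sum (orthogonal_biproduct_powers horth)]
  exact Finset.sum_congr rfl fun i _ => finrank_endAlgebra_biproduct (B i) (n i + 1)

/-- `End⁰(⨁_{Fin 1} B) ≅ End⁰(B)`: commutativity transfers (`⨁_{Fin 1} B ∼ B`).
[cite: MumfordAV1970, §19 (p. 174)] -/
theorem endAlgebra_biproduct_fin_one_comm_iff (B : AbelianVariety k) :
    (∀ x y : (⨁ fun _ : Fin (0 + 1) => B).endAlgebra, x * y = y * x) ↔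
      ∀ x y : B.endAlgebra, x * y = y * x := by
  have h : IsIsogenous (⨁ fun _ : Fin (0 + 1) => B) B := by
    have := isIsogenous_biproduct_powSucc B 0
    rwa [AbelianVariety.powSucc_zero] at this
  exact h.endAlgebra_comm_iff

/-- **`End⁰(⨁ᵢ Bᵢ^{nᵢ+1})` is commutative iff every `nᵢ = 0` and every `End⁰(Bᵢ)` is commutative**
(orthogonal family, `dim Bᵢ > 0`: a matrix ring `Mat_m(D)`, `m ≥ 2`, `D ≠ 0`, is not commutative).
[cite: MumfordAV1970, §19 (p. 174)] -/
theorem endAlgebra_biproduct_powers_comm_iff (horth : ∀ j l, j ≠ l → ∀ f : B j ⟶ B l, f = 0)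
    (hB : ∀ i, 0 < (B i).dim) :
    (∀ x y : (⨁ fun i => ⨁ fun _ : Fin (n i + 1) => B i).endAlgebra, x * y = y * x) ↔
      (∀ i, n i = 0) ∧ ∀ i, ∀ x y : (B i).endAlgebra, x * y = y * x := by
  rw [endAlgebra_biproduct_comm_iff (orthogonal_biproduct_powers horth)]
  constructor
  · intro h
    have hn : ∀ i, n i = 0 := fun i => by
      by_contra hi
      obtain ⟨x, y, hxy⟩ := exists_mul_ne_mul_endAlgebra_biproduct (m := n i + 1) (hB i) (by omega)
      exact hxy (h i x y)
    refine ⟨hn, fun i => ?_⟩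
    have hi := h i
    rw [hn i] at hi
    exact (endAlgebra_biproduct_fin_one_comm_iff (B i)).1 hi
  · rintro ⟨hn, hc⟩ i
    rw [hn i]
    exact (endAlgebra_biproduct_fin_one_comm_iff (B i)).2 (hc i)

end AnyField

/-! ## §2 Over `ℂ`: products of powers of pairwise non-isogenous simple CM abelian varieties -/

section Complex

/-- Arithmetic: `2 (m+1) d ≤ (m+1)² · 2d`. [cite: MumfordAV1970, §19 (p. 174), auxiliary step] -/
private theorem two_mul_le_sq_mul (m d : ℕ) : 2 * ((m + 1) * d) ≤ (m + 1) ^ 2 * (2 * d) := by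
  have key : (m + 1) ^ 2 * (2 * d) = 2 * ((m + 1) * d) + m * (2 * ((m + 1) * d)) := by ring
  omega

/-- Arithmetic: `2 (m+1) d = (m+1)² · 2d` with `d > 0` forces `m = 0`. [cite: MumfordAV1970, §19 (p. 174), auxiliary step] -/
private theorem eq_zero_of_two_mul_eq_sq_mul {m d : ℕ} (hd : 0 < d)
    (h : 2 * ((m + 1) * d) = (m + 1) ^ 2 * (2 * d)) : m = 0 := by
  have key : (m + 1) ^ 2 * (2 * d) = 2 * ((m + 1) * d) + m * (2 * ((m + 1) * d)) := by ring
  rw [key] at h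
  have hm : m * (2 * ((m + 1) * d)) = 0 := by omega
  rcases Nat.mul_eq_zero.1 hm with h0 | h0
  · exact h0
  · exfalso
    have : 0 < 2 * ((m + 1) * d) := by positivity
    omega

variable {r : ℕ} {B : Fin r → AbelianVariety ℂ} {n : Fin r → ℕ} {A : AbelianVariety ℂ}

/-- Pairwise non-isogenous `Bᵢ` with `End⁰(Bᵢ)` fields (hence simple) are orthogonal.
[cite: MumfordAV1970, §19 Cor. 2 of Thm. 3] -/
theorem orthogonal_of_isOfCMTypeSimple (hB : ∀ i, IsOfCMTypeSimple (B i))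
    (hni : ∀ j l, j ≠ l → ¬ IsIsogenous (B j) (B l)) :
    ∀ j l, j ≠ l → ∀ f : B j ⟶ B l, f = 0 :=
  orthogonal_of_isSimple_of_not_isIsogenous (fun i => isSimple_of_isField_endAlgebra (hB i).1) hni

/-- `dim (⨁ᵢ Bᵢ^{nᵢ+1}) = Σᵢ (nᵢ+1) dim Bᵢ`. [cite: MumfordAV1970, §19] -/
theorem dim_biproduct_powers :
    (⨁ fun i => ⨁ fun _ : Fin (n i + 1) => B i).dim = ∑ i, (n i + 1) * (B i).dim := by
  rw [dim_biproduct_fin]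
  exact Finset.sum_congr rfl fun i _ => dim_biproduct_const (B i) (n i + 1)

/-- **`dim_ℚ End⁰(A) = Σᵢ (nᵢ+1)² · 2 dim Bᵢ`** for `A ∼ ⨁ᵢ Bᵢ^{nᵢ+1}`, `Bᵢ` pairwise non-isogenous with
`End⁰(Bᵢ)` a field of degree `2 dim Bᵢ` (Mumford `⊕ M_{nᵢ}(Dᵢ)` with `Dᵢ = Kᵢ` a CM field, Shimura
§5.1 Prop. 6: `g = 1`). [cite: MumfordAV1970, §19 (p. 174)] [cite: Shimura1998, §5.1 Propositions 4 and 6] -/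
theorem finrank_endAlgebra_of_isIsogenous_cmPowers (hB : ∀ i, IsOfCMTypeSimple (B i))
    (hni : ∀ j l, j ≠ l → ¬ IsIsogenous (B j) (B l))
    (hA : IsIsogenous A (⨁ fun i => ⨁ fun _ : Fin (n i + 1) => B i)) :
    Module.finrank ℚ A.endAlgebra = ∑ i, (n i + 1) ^ 2 * (2 * (B i).dim) := by
  rw [hA.finrank_endAlgebra_eq, finrank_endAlgebra_biproduct_powers (orthogonal_of_isOfCMTypeSimple hB hni)]
  exact Finset.sum_congr rfl fun i _ => by rw [(hB i).2]

/-- **`2 dim A ≤ dim_ℚ End⁰(A)`** for such `A` (`Σ (nᵢ+1) 2 dim Bᵢ ≤ Σ (nᵢ+1)² 2 dim Bᵢ`).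
[cite: Shimura1998, §5.1 Propositions 1, 4 and 6] -/
theorem two_mul_dim_le_finrank_endAlgebra_of_isIsogenous_cmPowers (hB : ∀ i, IsOfCMTypeSimple (B i))
    (hni : ∀ j l, j ≠ l → ¬ IsIsogenous (B j) (B l))
    (hA : IsIsogenous A (⨁ fun i => ⨁ fun _ : Fin (n i + 1) => B i)) :
    2 * A.dim ≤ Module.finrank ℚ A.endAlgebra := by
  obtain ⟨u, hu⟩ := hA
  rw [finrank_endAlgebra_of_isIsogenous_cmPowers hB hni ⟨u, hu⟩, dim_eq_of_isIsogeny hu,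
    dim_biproduct_powers, Finset.mul_sum]
  exact Finset.sum_le_sum fun i _ => two_mul_le_sq_mul (n i) (B i).dim

/-- **`dim_ℚ End⁰(A) = 2 dim A` iff all `nᵢ = 0`** (iff `A` is isogenous to a product of pairwise
non-isogenous simple CM abelian varieties; `dim Bᵢ > 0`). [cite: Shimura1998, §5.1 Propositions 1, 4 and 6] -/
theorem finrank_endAlgebra_eq_two_mul_dim_iff (hB : ∀ i, IsOfCMTypeSimple (B i))
    (hni : ∀ j l, j ≠ l → ¬ IsIsogenous (B j) (B l))
    (hA : IsIsogenous A (⨁ fun i => ⨁ fun _ : Fin (n i + 1) => B i)) :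
    Module.finrank ℚ A.endAlgebra = 2 * A.dim ↔ ∀ i, n i = 0 := by
  obtain ⟨u, hu⟩ := hA
  have hd : ∀ i, 0 < (B i).dim := fun i => dim_pos_of_isOfCMTypeSimple (hB i)
  rw [finrank_endAlgebra_of_isIsogenous_cmPowers hB hni ⟨u, hu⟩, dim_eq_of_isIsogeny hu,
    dim_biproduct_powers, Finset.mul_sum]
  constructor
  · intro h
    -- termwise `(nᵢ+1)·2dᵢ ≤ (nᵢ+1)²·2dᵢ`; equality of the sums forces termwise equality
    have hle : ∀ i ∈ Finset.univ, 2 * ((n i + 1) * (B i).dim) ≤ (n i + 1) ^ 2 * (2 * (B i).dim) :=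
      fun i _ => two_mul_le_sq_mul (n i) (B i).dim
    have heq := (Finset.sum_eq_sum_iff_of_le hle).1 h.symm
    exact fun i => eq_zero_of_two_mul_eq_sq_mul (hd i) (heq i (Finset.mem_univ i))
  · intro h
    exact Finset.sum_congr rfl fun i _ => by rw [h i]; ring

/-- **`End⁰(A)` is commutative iff all `nᵢ = 0`** for `A ∼ ⨁ᵢ Bᵢ^{nᵢ+1}` with `Bᵢ` pairwise non-isogenous
simple CM: an abelian variety of CM-type has commutative `End⁰` exactly when its simple factors occur with
multiplicity one. [cite: MumfordAV1970, §19 (p. 174)] [cite: Shimura1998, §5.1 Propositions 3, 4 and 6] -/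
theorem endAlgebra_comm_iff_of_isIsogenous_cmPowers (hB : ∀ i, IsOfCMTypeSimple (B i))
    (hni : ∀ j l, j ≠ l → ¬ IsIsogenous (B j) (B l))
    (hA : IsIsogenous A (⨁ fun i => ⨁ fun _ : Fin (n i + 1) => B i)) :
    (∀ x y : A.endAlgebra, x * y = y * x) ↔ ∀ i, n i = 0 := by
  rw [hA.endAlgebra_comm_iff, endAlgebra_biproduct_powers_comm_iff (orthogonal_of_isOfCMTypeSimple hB hni)
    fun i => dim_pos_of_isOfCMTypeSimple (hB i)]
  exact ⟨fun h => h.1, fun h => ⟨h, fun i x y => (hB i).1.mul_comm x y⟩⟩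

/-- **Equivalently: `End⁰(A)` is commutative iff `dim_ℚ End⁰(A) = 2 dim A`** (for such `A`).
[cite: Shimura1998, §5.1 Propositions 1, 3, 4 and 6] -/
theorem endAlgebra_comm_iff_finrank_eq_two_mul_dim (hB : ∀ i, IsOfCMTypeSimple (B i))
    (hni : ∀ j l, j ≠ l → ¬ IsIsogenous (B j) (B l))
    (hA : IsIsogenous A (⨁ fun i => ⨁ fun _ : Fin (n i + 1) => B i)) :
    (∀ x y : A.endAlgebra, x * y = y * x) ↔ Module.finrank ℚ A.endAlgebra = 2 * A.dim := by
  rw [endAlgebra_comm_iff_of_isIsogenous_cmPowers hB hni hA, finrank_endAlgebra_eq_two_mul_dim_iff hB hni hA]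

end Complex

end Part1

/-! ## Part 2: the structure of End⁰(X) for every complex abelian variety; the CM case -/

section Part2

open _root_.CategoryTheory _root_.CategoryTheory.Limits

open Literature.AlgebraicGeometry.Motives Literature.AlgebraicGeometry.Motives.AbelianVariety
open Literature.AlgebraicGeometry.ComplexMultiplication
open Literature.AlgebraicGeometry.Milne1999 (IsOfCMType IsOfCMTypeSimple)
open Literature.AlgebraicGeometry.ComplexMultiplication.AndreRiemann Literature.AlgebraicGeometry.ComplexMultiplication.EndAlgebraPower

/-! ## §1 CM-type of finite biproducts -/

/-- **`⨁_{Fin m} A i` is of CM-type iff every `A i` is** (the tree's `isOfCMType_prod_iff`, by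
induction through `⨁_{Fin (m+1)} A ≅ A 0 × ⨁_{Fin m} (A ∘ succ)`, `AndreRiemann.biproduct_succ_split`;
the empty biproduct has dimension `0`). [cite: Milne1999, §2 p. 54] -/
theorem isOfCMType_biproduct_fin_iff : ∀ {m : ℕ} (A : Fin m → AbelianVariety ℂ),
    IsOfCMType (⨁ A) ↔ ∀ i, IsOfCMType (A i)
  | 0, A => by
    refine ⟨fun _ i => Fin.elim0 i, fun _ => ?_⟩
    exact Literature.AlgebraicGeometry.Milne1999.isOfCMType_of_dim_eq_zero (dim_biproduct_fin_zero A)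
  | m + 1, A => by
    obtain ⟨h, g, hhg, hgh⟩ := biproduct_succ_split A
    have hiso : IsIsogenous (⨁ A) ((A 0).prod (⨁ (A ∘ Fin.succ))) :=
      ⟨h, isIsogeny_hom_of_iso ⟨h, g, hhg, hgh⟩⟩
    rw [Literature.AlgebraicGeometry.Milne1999.isOfCMType_iff_of_isIsogenous hiso,
      Literature.AlgebraicGeometry.Milne1999.isOfCMType_prod_iff, isOfCMType_biproduct_fin_iff (A ∘ Fin.succ)]
    constructor
    · rintro ⟨h0, hs⟩ i
      exact Fin.cases h0 (fun j => hs j) i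
    · intro hall
      exact ⟨hall 0, fun j => hall j.succ⟩

/-- **`⨁ᵢ Bᵢ^{nᵢ+1}` is of CM-type iff every `Bᵢ` is.** [cite: Milne1999, §2 p. 54] -/
theorem isOfCMType_biproduct_powers_iff {r : ℕ} (B : Fin r → AbelianVariety ℂ) (n : Fin r → ℕ) :
    IsOfCMType (⨁ fun i => ⨁ fun _ : Fin (n i + 1) => B i) ↔ ∀ i, IsOfCMType (B i) := by
  rw [isOfCMType_biproduct_fin_iff]
  refine forall_congr' fun i => ?_
  rw [isOfCMType_biproduct_fin_iff]
  exact ⟨fun h => h 0, fun h _ => h⟩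

/-! ## §2 The structure of `End⁰(X)` for every complex abelian variety -/

/-- **Mumford §19 (Cor. 1 of Thm. 1 and p. 174) for every complex abelian variety `X`**: there are
simple, positive-dimensional, pairwise non-isogenous `B₀, …, B_{r-1}` and multiplicities with
`X ∼ ⨁ᵢ Bᵢ^{nᵢ+1}`; for any such data `dim_ℚ End⁰(X) = Σᵢ (nᵢ+1)² dim_ℚ End⁰(Bᵢ)`
(`End⁰(X) ≅ ⊕ᵢ M_{nᵢ+1}(End⁰ Bᵢ)`), and `End⁰(X)` is commutative iff all `nᵢ = 0` and all `End⁰(Bᵢ)`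
are commutative. [cite: MumfordAV1970, §19 Thm. 1 Cor. 1–2 and p. 174] -/
theorem exists_endAlgebra_structure (X : AbelianVariety ℂ) :
    ∃ (r : ℕ) (B : Fin r → AbelianVariety ℂ) (n : Fin r → ℕ),
      (∀ i, (B i).IsSimple) ∧ (∀ i, 0 < (B i).dim) ∧ (∀ i j, i ≠ j → ¬ IsIsogenous (B i) (B j)) ∧
      IsIsogenous X (⨁ fun i => ⨁ fun _ : Fin (n i + 1) => B i) ∧
      Module.finrank ℚ X.endAlgebra = ∑ i, (n i + 1) ^ 2 * Module.finrank ℚ (B i).endAlgebra ∧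
      ((∀ x y : X.endAlgebra, x * y = y * x) ↔
        (∀ i, n i = 0) ∧ ∀ i, ∀ x y : (B i).endAlgebra, x * y = y * x) := by
  obtain ⟨r, B, n, hS, hd, hni, hX⟩ := exists_isIsogenous_biproduct_powers_fin X
  have horth := orthogonal_of_isSimple_of_not_isIsogenous hS hni
  refine ⟨r, B, n, hS, hd, hni, hX, ?_, ?_⟩
  · rw [hX.finrank_endAlgebra_eq, finrank_endAlgebra_biproduct_powers horth]
  · rw [hX.endAlgebra_comm_iff, endAlgebra_biproduct_powers_comm_iff horth hd]

/-! ## §3 The structure of `End⁰(X)` for every complex abelian variety of CM-type -/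

/-- **Every complex abelian variety of CM-type is `∼ ⨁ᵢ Bᵢ^{nᵢ+1}` with `Bᵢ` simple CM
(`End⁰(Bᵢ)` a field of degree `2 dim Bᵢ`), pairwise non-isogenous; then
`dim_ℚ End⁰(X) = Σᵢ (nᵢ+1)² · 2 dim Bᵢ`, `dim X = Σᵢ (nᵢ+1) dim Bᵢ`, and `End⁰(X)` is commutative iff
all `nᵢ = 0` iff `dim_ℚ End⁰(X) = 2 dim X`** (Mumford §19 p. 174 with Shimura §5.1 Props. 4, 6:
`End⁰(X) = ⊕ᵢ M_{nᵢ+1}(Kᵢ)`, `Kᵢ` CM fields). [cite: MumfordAV1970, §19 Thm. 1 Cor. 1–2 and p. 174]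
[cite: Shimura1998, §5.1 Propositions 3, 4 and 6] [cite: Milne1999, §2 p. 54] -/
theorem IsOfCMType.exists_endAlgebra_structure {X : AbelianVariety ℂ} (hX : IsOfCMType X) :
    ∃ (r : ℕ) (B : Fin r → AbelianVariety ℂ) (n : Fin r → ℕ),
      (∀ i, (B i).IsSimple) ∧ (∀ i, IsOfCMTypeSimple (B i)) ∧
      (∀ i j, i ≠ j → ¬ IsIsogenous (B i) (B j)) ∧
      IsIsogenous X (⨁ fun i => ⨁ fun _ : Fin (n i + 1) => B i) ∧
      X.dim = ∑ i, (n i + 1) * (B i).dim ∧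
      Module.finrank ℚ X.endAlgebra = ∑ i, (n i + 1) ^ 2 * (2 * (B i).dim) ∧
      ((∀ x y : X.endAlgebra, x * y = y * x) ↔ ∀ i, n i = 0) ∧
      ((∀ x y : X.endAlgebra, x * y = y * x) ↔ Module.finrank ℚ X.endAlgebra = 2 * X.dim) := by
  obtain ⟨r, B, n, hS, hd, hni, hXT⟩ := exists_isIsogenous_biproduct_powers_fin X
  -- the factors are CM
  have hT : IsOfCMType (⨁ fun i => ⨁ fun _ : Fin (n i + 1) => B i) :=
    (Literature.AlgebraicGeometry.Milne1999.isOfCMType_iff_of_isIsogenous hXT).1 hX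
  have hBcm : ∀ i, IsOfCMTypeSimple (B i) := fun i =>
    (((isOfCMType_biproduct_powers_iff B n).1 hT) i).isOfCMTypeSimple (hS i) (hd i)
  refine ⟨r, B, n, hS, hBcm, hni, hXT, ?_, finrank_endAlgebra_of_isIsogenous_cmPowers hBcm hni hXT,
    endAlgebra_comm_iff_of_isIsogenous_cmPowers hBcm hni hXT,
    endAlgebra_comm_iff_finrank_eq_two_mul_dim hBcm hni hXT⟩
  obtain ⟨u, hu⟩ := hXT
  rw [dim_eq_of_isIsogeny hu, dim_biproduct_powers]

/-- **For a complex abelian variety of CM-type, `2 dim X ≤ dim_ℚ End⁰(X) ≤ …` — the multiplicity-one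
criterion**: `End⁰(X)` is a product of (CM) fields iff `X` is isogenous to a product of pairwise
non-isogenous simple CM abelian varieties, i.e. iff all multiplicities are one; in the decomposition of
`IsOfCMType.exists_endAlgebra_structure` this reads `∀ i, nᵢ = 0`.  Recorded as the special case:
`End⁰(X)` commutative ⟹ `X ∼ ⨁ᵢ Bᵢ` (no repeated factor). [cite: MumfordAV1970, §19 (p. 174)]
[cite: Shimura1998, §5.1 Propositions 3, 4 and 6] -/
theorem IsOfCMType.exists_isIsogenous_biproduct_simple_of_comm {X : AbelianVariety ℂ} (hX : IsOfCMType X)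
    (hcomm : ∀ x y : X.endAlgebra, x * y = y * x) :
    ∃ (r : ℕ) (B : Fin r → AbelianVariety ℂ),
      (∀ i, (B i).IsSimple) ∧ (∀ i, IsOfCMTypeSimple (B i)) ∧
      (∀ i j, i ≠ j → ¬ IsIsogenous (B i) (B j)) ∧
      IsIsogenous X (⨁ fun i => ⨁ fun _ : Fin (0 + 1) => B i) := by
  obtain ⟨r, B, n, hS, hBcm, hni, hXT, -, -, hcommiff, -⟩ := IsOfCMType.exists_endAlgebra_structure hX
  have hn : ∀ i, n i = 0 := hcommiff.1 hcomm
  have hn' : n = fun _ => 0 := funext hn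
  subst hn'
  exact ⟨r, B, hS, hBcm, hni, hXT⟩

end Part2

end Literature.AlgebraicGeometry.ComplexMultiplication.CMProductEnd

end
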